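import Mathlib
import Summits.MatrixMultiplication.MatrixMultiplication.Theorems.SnSubsetDichotomyHyperoctahedralThresholdCleanPairDefs

/-!
# Clean-pair atom §1: the absorbing set (`SnSubsetDichotomy.HyperoctahedralThreshold`, stmt-10883)

Helper for crux `SnSubsetDichotomy.HyperoctahedralThreshold` (stmt-MatrixMultiplication-10883), line
`stub_plan_poorRigidCore`, clean-pair atom, depth recursion §1 (proof plan `work/ATOM_PROOF.md` of the stub-plan seat).

Three involutions `μ c` of `Fin n` act on the right on colour words (`TwinSupplyCS.act`); `closedAt μ m u` is the finset
of reduced words of length `m` closed at `u`, `T_m := ∑_u |closedAt μ m u|`.  Under the fixed-point hypothesis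
`|Fix w| ≤ Φ₀` for every nonempty reduced `w` of length `≤ 2a`:

* `Absorb.sum_card_closedAt_le` — `T_m ≤ |RW m| · Φ₀ = 3 · 2^(m-1) · Φ₀` for `1 ≤ m ≤ 2a` (swap the double count:
  `T_m = ∑_{w ∈ RW m} |Fix w|`).
* `Absorb.card_filter_nonempty_le` — `#{u : closedAt μ m u ≠ ∅} ≤ T_m`.
* `Absorb.mul_card_filter_dense_le` — Markov: `2^m · #{u : 2^m < s₀ |closedAt μ m u|} ≤ s₀ · T_m`.
* `stub_absorbingSet` (registered form) — the absorbing set `F := R ∪ F_cyc ∪ F_dense`,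
  `F_cyc := {u : some nonempty reduced closed walk of length ≤ 2r at u}`,
  `F_dense := {u : ∃ 1 ≤ m ≤ 2a, 2^m < s₀ · |closedAt μ m u|}`:
  it contains `R`, has no short reduced cycle outside (`CleanPair.NoShortCycleOutside μ F r`), every point outside is
  `s₀`-sparse at all lengths `1 ≤ m ≤ 2a`, and `|F| ≤ |R| + 3 · 2^(2r+1) · Φ₀ + 6 a s₀ Φ₀`
  (`|F_cyc| ≤ ∑_{m ≤ 2r} T_m ≤ 3 Φ₀ ∑_{i<2r} 2^i < 3 Φ₀ 2^(2r)`, `|F_dense| ≤ ∑_{m ≤ 2a} s₀ T_m / 2^m ≤ 2a · 3 s₀ Φ₀`).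

Pure finite counting; no definitions (the set `F` is an explicit term of the proof).
-/

-- the tree's namespace `Summit.MatrixMultiplication.MatrixMultiplication.…` repeats a component by design
set_option linter.dupNamespace false

namespace Summit.MatrixMultiplication.MatrixMultiplication.Theorems.HyperoctahedralThreshold

namespace CleanPair.Absorb

open Finset TwinSupplyCS

variable {n : ℕ}

/-- Swapping the double count: `T_m = ∑_u |closedAt μ m u| = ∑_{w ∈ RW m} |Fix w| ≤ |RW m| · Φ₀ = 3 · 2^(m-1) · Φ₀`
for `1 ≤ m ≤ 2a`, when every nonempty reduced word of length `≤ 2a` fixes at most `Φ₀` points. -/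
theorem sum_card_closedAt_le (μ : Fin 3 → Equiv.Perm (Fin n)) {a Φ₀ : ℕ}
    (hΦ : ∀ w : List (Fin 3), w ≠ [] → List.IsChain (· ≠ ·) w → w.length ≤ 2 * a →
      ((univ : Finset (Fin n)).filter (fun y => w.foldl (fun v b => μ b v) y = y)).card ≤ Φ₀)
    {m : ℕ} (hm1 : 1 ≤ m) (hma : m ≤ 2 * a) :
    ∑ u, (closedAt μ m u).card ≤ 3 * 2 ^ (m - 1) * Φ₀ := by
  calc ∑ u, (closedAt μ m u).card
      = ∑ u, ∑ w ∈ RW m, if act μ u w = u then 1 else 0 := by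
        refine sum_congr rfl fun u _ => ?_
        simp only [closedAt, card_filter]
    _ = ∑ w ∈ RW m, ∑ u, if act μ u w = u then 1 else 0 := sum_comm
    _ = ∑ w ∈ RW m, ((univ : Finset (Fin n)).filter (fun u => act μ u w = u)).card := by
        refine sum_congr rfl fun w _ => ?_
        rw [card_filter]
    _ ≤ ∑ w ∈ RW m, Φ₀ := by
        refine sum_le_sum fun w hw => ?_
        rw [mem_RW] at hw
        have hne : w ≠ [] := by rintro rfl; simp at hw; omega
        exact hΦ w hne hw.2 (hw.1 ▸ hma)
    _ = 3 * 2 ^ (m - 1) * Φ₀ := by rw [sum_const, smul_eq_mul, card_RW hm1]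

/-- The points carrying a closed reduced walk of length `m` number at most `T_m`. -/
theorem card_filter_nonempty_le (μ : Fin 3 → Equiv.Perm (Fin n)) (m : ℕ) :
    ((univ : Finset (Fin n)).filter (fun u => (closedAt μ m u).Nonempty)).card ≤ ∑ u, (closedAt μ m u).card := by
  rw [card_filter]
  refine sum_le_sum fun u _ => ?_
  split_ifs with h
  · exact h.card_pos
  · exact Nat.zero_le _

/-- Markov: `2^m · #{u : 2^m < s₀ · |closedAt μ m u|} ≤ s₀ · T_m`. -/
theorem mul_card_filter_dense_le (μ : Fin 3 → Equiv.Perm (Fin n)) (m s₀ : ℕ) :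
    2 ^ m * ((univ : Finset (Fin n)).filter (fun u => 2 ^ m < s₀ * (closedAt μ m u).card)).card ≤
      s₀ * ∑ u, (closedAt μ m u).card := by
  set D := (univ : Finset (Fin n)).filter (fun u => 2 ^ m < s₀ * (closedAt μ m u).card) with hD
  calc 2 ^ m * D.card = ∑ _u ∈ D, 2 ^ m := by rw [sum_const, smul_eq_mul, mul_comm]
    _ ≤ ∑ u ∈ D, s₀ * (closedAt μ m u).card := sum_le_sum fun u hu => (mem_filter.mp hu).2.le
    _ ≤ ∑ u, s₀ * (closedAt μ m u).card := sum_le_sum_of_subset (subset_univ _)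
    _ = s₀ * ∑ u, (closedAt μ m u).card := by rw [mul_sum]

end CleanPair.Absorb

open Finset TwinSupplyCS CleanPair CleanPair.Absorb in
/-- **`stub_absorbingSet`** (registered sub-goal of stmt-MatrixMultiplication-10883; clean-pair atom §1): the absorbing set
`F = R ∪ F_cyc ∪ F_dense` — contains `R`, no nonempty reduced closed walk of length `≤ 2r` outside, `s₀`-sparse closed-walk
counts outside at all lengths `1 ≤ m ≤ 2a`, and `|F| ≤ |R| + 3 · 2^(2r+1) · Φ₀ + 6 a s₀ Φ₀`.  See the module docstring. -/
theorem stub_absorbingSet : ∀ (n a r s₀ Φ₀ : ℕ) (μ : Fin 3 → Equiv.Perm (Fin n)) (R : Finset (Fin n)), (∀ c, μ c * μ c = 1) → r ≤ a → 0 < s₀ → (∀ w : List (Fin 3), w ≠ [] → List.IsChain (· ≠ ·) w → w.length ≤ 2 * a → ((Finset.univ : Finset (Fin n)).filter (fun y => w.foldl (fun v b => μ b v) y = y)).card ≤ Φ₀) → ∃ F : Finset (Fin n), R ⊆ F ∧ Summit.MatrixMultiplication.MatrixMultiplication.Theorems.HyperoctahedralThreshold.CleanPair.NoShortCycleOutside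 μ F r ∧ (∀ y ∉ F, ∀ m, 1 ≤ m → m ≤ 2 * a → s₀ * (Summit.MatrixMultiplication.MatrixMultiplication.Theorems.HyperoctahedralThreshold.TwinSupplyCS.closedAt μ m y).card ≤ 2 ^ m) ∧ F.card ≤ R.card + 3 * 2 ^ (2 * r + 1) * Φ₀ + 6 * a * s₀ * Φ₀ := by
  intro n a r s₀ Φ₀ μ R _ hra _ hΦ
  -- the two layers, indexed by `i = m - 1`
  obtain ⟨Fcyc, hFcyc⟩ : ∃ S : Finset (Fin n),
      S = (range (2 * r)).biUnion fun i => univ.filter fun u => (closedAt μ (i + 1) u).Nonempty := ⟨_, rfl⟩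
  obtain ⟨Fdense, hFdense⟩ : ∃ S : Finset (Fin n),
      S = (range (2 * a)).biUnion fun i => univ.filter fun u => 2 ^ (i + 1) < s₀ * (closedAt μ (i + 1) u).card :=
    ⟨_, rfl⟩
  refine ⟨R ∪ Fcyc ∪ Fdense, subset_union_left.trans subset_union_left, ?_, ?_, ?_⟩
  · -- no short reduced cycle outside `F ⊇ F_cyc`
    intro y hy w hne hc hlen hact
    have hpos : 0 < w.length := List.length_pos_iff.mpr hne
    apply hy
    refine mem_union_left _ (mem_union_right _ ?_)
    rw [hFcyc, mem_biUnion]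
    refine ⟨w.length - 1, by rw [mem_range]; omega, ?_⟩
    rw [mem_filter]
    exact ⟨mem_univ _, w, mem_closedAt.mpr ⟨⟨by omega, hc⟩, hact⟩⟩
  · -- sparse outside `F ⊇ F_dense`
    intro y hy m hm1 hma
    by_contra hlt
    push Not at hlt
    apply hy
    refine mem_union_right _ ?_
    rw [hFdense, mem_biUnion]
    refine ⟨m - 1, by rw [mem_range]; omega, ?_⟩
    rw [mem_filter, Nat.sub_add_cancel hm1]
    exact ⟨mem_univ _, hlt⟩
  · -- sizes
    have hT : ∀ i, i < 2 * a → ∑ u, (closedAt μ (i + 1) u).card ≤ 3 * 2 ^ i * Φ₀ := fun i hi => by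
      simpa using sum_card_closedAt_le μ hΦ (m := i + 1) (by omega) (by omega)
    have hcyc : Fcyc.card ≤ 3 * 2 ^ (2 * r + 1) * Φ₀ := by
      calc Fcyc.card
          ≤ ∑ i ∈ range (2 * r), ((univ : Finset (Fin n)).filter fun u => (closedAt μ (i + 1) u).Nonempty).card := by
            rw [hFcyc]; exact card_biUnion_le
        _ ≤ ∑ i ∈ range (2 * r), 3 * 2 ^ i * Φ₀ := by
            refine sum_le_sum fun i hi => (card_filter_nonempty_le μ (i + 1)).trans (hT i ?_)
            rw [mem_range] at hi
            omega
        _ = 3 * Φ₀ * ∑ i ∈ range (2 * r), 2 ^ i := by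
            rw [mul_sum]
            exact sum_congr rfl fun i _ => by ring
        _ ≤ 3 * Φ₀ * 2 ^ (2 * r) :=
            Nat.mul_le_mul_left _ (Nat.geomSum_lt (le_refl 2) fun k hk => mem_range.mp hk).le
        _ ≤ 2 * (3 * Φ₀ * 2 ^ (2 * r)) := Nat.le_mul_of_pos_left _ two_pos
        _ = 3 * 2 ^ (2 * r + 1) * Φ₀ := by ring
    have hdense : Fdense.card ≤ 6 * a * s₀ * Φ₀ := by
      calc Fdense.card
          ≤ ∑ i ∈ range (2 * a),
              ((univ : Finset (Fin n)).filter fun u => 2 ^ (i + 1) < s₀ * (closedAt μ (i + 1) u).card).card := by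
            rw [hFdense]; exact card_biUnion_le
        _ ≤ ∑ i ∈ range (2 * a), 3 * s₀ * Φ₀ := by
            refine sum_le_sum fun i hi => ?_
            rw [mem_range] at hi
            refine Nat.le_of_mul_le_mul_left (c := 2 ^ (i + 1)) ?_ (by positivity)
            calc 2 ^ (i + 1) *
                  ((univ : Finset (Fin n)).filter fun u => 2 ^ (i + 1) < s₀ * (closedAt μ (i + 1) u).card).card
                ≤ s₀ * ∑ u, (closedAt μ (i + 1) u).card := mul_card_filter_dense_le μ (i + 1) s₀
              _ ≤ s₀ * (3 * 2 ^ i * Φ₀) := Nat.mul_le_mul_left _ (hT i hi)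
              _ ≤ 2 * (s₀ * (3 * 2 ^ i * Φ₀)) := Nat.le_mul_of_pos_left _ two_pos
              _ = 2 ^ (i + 1) * (3 * s₀ * Φ₀) := by ring
        _ = 6 * a * s₀ * Φ₀ := by rw [sum_const, card_range, smul_eq_mul]; ring
    calc (R ∪ Fcyc ∪ Fdense).card ≤ (R ∪ Fcyc).card + Fdense.card := card_union_le _ _
      _ ≤ R.card + Fcyc.card + Fdense.card := Nat.add_le_add_right (card_union_le _ _) _
      _ ≤ R.card + 3 * 2 ^ (2 * r + 1) * Φ₀ + 6 * a * s₀ * Φ₀ := add_le_add (Nat.add_le_add_left hcyc _) hdense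

end Summit.MatrixMultiplication.MatrixMultiplication.Theorems.HyperoctahedralThreshold
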